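import Summits.Ventures.PercRepro.RankLevelSetExplicitLin2CellsArith
import Summits.Ventures.PercRepro.RankLevelSetExplicitLin

/-!
# PercRepro — THE PER-CORANK CELL MAP OF THEOREM P⁗″: a core cell `(p, d)` at level `q ≥ 8` closes for
`p ≥ Tcell2 q d k = max(320q, 3(q+5)d, 3q·k·2^{⌈q/2⌉})` with `d + 2 ≤ k²`, `3k² ≤ 2^q` (p9, S4)

`proofs/SUBCLAIM-S4-p9.md` §S4.3⁗. The `e`-free core of rank `p` and corank `d ≥ q + 2` satisfies C-025 at level `q ≥ 8`
as soon as `p ≥ Tcell2 q d k` — POLYNOMIAL in the corank (the small class scales as `√d`, the big class as `d`), against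
the cell's earlier map `Tcell(q, m) = q²·2^{⌊(qm+3q+10)/2⌋+1} + …` (§S4.3″), exponential in the corank. The proof is
`c025_core_lin2_bounded` with BOTH flat bounds replaced by the nullity cap (`|X| ≤ ρ(X) + d`: both weights at
`W·d ≤ 2^d`), the `(Y)`-tail at `K = q + d`, and `poly_cells`; the matroid part is stated once, for ANY assembled inequality
(`c025_core_cell_of_poly`), so that other thresholds (the corank-`(q+1)` map of `RankLevelSetExplicitLin2CellsSucc`) reuse it. Examples: at level `10`, corank `12` closes from
`p = 3 840` (`k = 4`) and corank `100` from `10 560` (`k = 11`) — against the uniform `20 480`. Axioms: standard.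
-/

open scoped Matroid

namespace PercRepro

namespace ThmN

open Set

variable {α : Type}

/-- **THE CORE CELL FROM ITS ASSEMBLED INEQUALITY**: the `e`-free core at level `q ≥ 8`, rank `p ≥ 3(q+5)d`, corank
`d ≥ q + 1`, `p ≥ 320q`, satisfies `RLS M p q` as soon as the per-corank polynomial inequality `(P_d)` holds with both weights at
their cap: `8·(C(p+d, q) + W·A + W·B) ≤ 7·2^{d−q}·C(p+q, q)` for every `W` with `W·d ≤ 2^d`, every `A` with
`6A ≤ A6(q, d, p+d)` and every `B ≤ C((q+3)d + 2q − 2, q)` (the multiplicity count with the nullity cap in both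
classes, Lemma T, Lemma T4, Lemma `T_k`, the `(Y)`-tail at `K = q + d`). -/
theorem c025_core_cell_of_poly (q : ℕ) (hq : 8 ≤ q) (M : Matroid α) [M.Finite] (p d : ℕ)
    (hd1 : q + 1 ≤ d) (h1 : 320 * q ≤ p) (h2 : 3 * (q + 5) * d ≤ p)
    (hpoly : ∀ (A B : ℕ) (W : ℚ), W * d ≤ 2 ^ d →
      6 * A ≤ 3 * (d * (d + 1)) * (p + d).choose (q - 2) + 2 * (d * (d + 1) * (d + 2)) * (p + d).choose (q - 3) +
        6 * ((2 * d + 2 * q - 2).choose 4 * (2 * d + 2 * q - 6 + (p + d)).choose (q - 4)) →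
      B ≤ ((q + 3) * d + 2 * q - 2).choose q →
      8 * (((p + d).choose q : ℚ) + W * A + W * B) ≤ 7 * 2 ^ (d - q) * ((p + q).choose q : ℚ))
    (hR : M.eRank = (p : ℕ∞)) (hn : M.E.ncard = p + d)
    (hfree : ∀ e ∈ M.E, ∃ A ⊆ M.E \ {e}, e ∉ M.closure A ∧ e ∉ M.closure ((M.E \ {e}) \ A)) :
    RLS M p q := by
  classical
  have hEcard : M.ground_finite.toFinset.card = p + d := by
    rw [← Set.ncard_eq_toFinset_card _ M.ground_finite]; exact hn
  -- the core is simple: every circuit has `≥ 3` elements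
  have hL : ∀ e ∈ M.E, ¬ M.IsLoop e := not_isLoop_of_free M hfree
  have hs : ∀ e ∈ M.E, ∀ f ∈ M.E, e ≠ f → M.eRk {e, f} = 2 := by
    intro e he f hf hef
    have h2 : (2 : ℕ∞) ≤ M.eRk {e, f} :=
      two_le_eRk_of_two_le_ncard_of_free M hfree (pair_subset he hf) (by rw [ncard_pair hef])
    have h3 : M.eRk {e, f} ≤ 2 := by
      have := M.eRk_le_encard {e, f}
      rwa [encard_pair hef] at this
    exact le_antisymm h3 h2
  have hcirc : ∀ C, M.IsCircuit C → 3 ≤ C.encard := three_le_encard_of_circuit M hL hs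
  have hd : M.E.encard = M.eRank + d := by
    rw [hR, ← M.ground_finite.cast_ncard_eq, hn]
    push_cast
    ring
  -- the nullity cap: every `X ⊆ E` has `|X| ≤ r(X) + d`
  have hcap : ∀ X ⊆ M.E, ∀ k : ℕ, M.eRk X ≤ k → X.ncard ≤ k + d := by
    intro X hX k hr
    have h1 := Matroid.encard_le_eRk_add_of_encard_eq hX hd
    have h2 : X.encard ≤ (k : ℕ∞) + d := h1.trans (by gcongr)
    have hfin : X.Finite := M.ground_finite.subset hX
    rw [← hfin.cast_ncard_eq] at h2
    exact_mod_cast h2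
  have hflat : ∀ X ⊆ M.E, M.eRk X ≤ q → X.ncard ≤ q + d := fun X hX hr => hcap X hX q hr
  have hflat' : ∀ X ⊆ M.E, M.eRk X ≤ ((q - 1 : ℕ) : ℕ∞) → X.ncard ≤ q - 1 + d :=
    fun X hX hr => hcap X hX (q - 1) hr
  -- (U): the multiplicity count with both flat bounds at the cap
  have hU1 := Matroid.topCount_le_ncard_compl (M := M) hR hd q
  have hsum := Matroid.ncard_eRk_eq_ncard_le_le_sum (M := M) q d
  have hmul := fun m => Matroid.ncard_eRk_eq_ncard_eq_mul_le M q (q + d) (q - 1 + d) (by omega) hcirc hflat hflat' hd m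
  -- the circuit counts: Lemma T, Lemma T4, LEMMA `T_k`
  have hC1 : ∀ L ⊆ M.E, M.eRk L = 2 → L.ncard ≤ 3 :=
    fun L hL' hr => ncard_le_three_of_eRk_two M hs hfree hL' hr
  have hs3 : 2 * {C | M.IsCircuit C ∧ C.ncard = 3}.ncard ≤ d * (d + 1) := S1.two_mul_ncard_triangles_le M hC1 hd
  have hC1' : ∀ L ⊆ M.E, M.eRk L ≤ 2 → L.ncard ≤ 3 := by
    intro L hL' hr
    have := ncard_add_one_le_two_pow_of_eRk_le M hL hfree 2 L hL' hr
    omega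
  have hC2 : ∀ P ⊆ M.E, M.eRk P ≤ 3 → P.ncard ≤ 6 :=
    fun P hP hr => ncard_le_six_of_eRk_le_three_of_free M hfree hP hr
  have hs4 : 3 * {C : Set α | M.IsCircuit C ∧ C.ncard = 4}.ncard ≤ d * (d + 1) * (d + 2) :=
    S1.three_mul_ncard_four_circuits_le M hC1' hC2 hd
  have hsp : ∀ j : ℕ, ∀ X ⊆ M.E, M.eRk X ≤ j → X.ncard + 1 ≤ 2 ^ j :=
    fun j X hX hr => ncard_add_one_le_two_pow_of_eRk_le M hL hfree j X hX hr
  have hcsT : ∀ k, 1 ≤ k → {C | M.IsCircuit C ∧ C.ncard = k}.ncard ≤ 2 ^ (k - 1) * (d + k - 2).choose (k - 1) :=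
    fun k hk => Matroid.ncard_circuits_le_two_pow_mul_choose_of_free M hd hsp k hk
  -- the two class sums, bounded
  set A : ℕ := ∑ k ∈ Finset.Icc 3 (q + 1), {C | M.IsCircuit C ∧ C.ncard = k}.ncard * M.E.ncard.choose (q + 1 - k)
    with hAdef
  set B : ℕ := ∑ k ∈ Finset.Icc 3 (q + 1), {C | M.IsCircuit C ∧ C.ncard = k}.ncard * ((q + 1) * d).choose (q + 1 - k)
    with hBdef
  have hA : 6 * A ≤ 3 * (d * (d + 1)) * (p + d).choose (q - 2) + 2 * (d * (d + 1) * (d + 2)) * (p + d).choose (q - 3) +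
      6 * ((2 * d + 2 * q - 2).choose 4 * (2 * d + 2 * q - 6 + (p + d)).choose (q - 4)) := by
    rw [hAdef, hn, Explicit.sum_Icc_three_split q (by omega), show q + 1 - 3 = q - 2 by omega,
      show q + 1 - 4 = q - 3 by omega]
    have h5 : ∑ k ∈ Finset.Icc 5 (q + 1), {C | M.IsCircuit C ∧ C.ncard = k}.ncard * (p + d).choose (q + 1 - k) ≤
        (2 * d + 2 * q - 2).choose 4 * (2 * d + 2 * q - 6 + (p + d)).choose (q - 4) := by
      refine (Finset.sum_le_sum (fun k hk => Nat.mul_le_mul_right _ (hcsT k (by rw [Finset.mem_Icc] at hk; omega)))).trans ?_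
      exact Explicit.tail_sum_le_sparse q d (p + d) (by omega)
    have e3 : 6 * ({C | M.IsCircuit C ∧ C.ncard = 3}.ncard * (p + d).choose (q - 2)) ≤
        3 * (d * (d + 1)) * (p + d).choose (q - 2) := by
      calc 6 * ({C | M.IsCircuit C ∧ C.ncard = 3}.ncard * (p + d).choose (q - 2))
          = 3 * ((2 * {C | M.IsCircuit C ∧ C.ncard = 3}.ncard) * (p + d).choose (q - 2)) := by ring
        _ ≤ 3 * ((d * (d + 1)) * (p + d).choose (q - 2)) := Nat.mul_le_mul_left _ (Nat.mul_le_mul_right _ hs3)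
        _ = 3 * (d * (d + 1)) * (p + d).choose (q - 2) := by ring
    have e4 : 6 * ({C | M.IsCircuit C ∧ C.ncard = 4}.ncard * (p + d).choose (q - 3)) ≤
        2 * (d * (d + 1) * (d + 2)) * (p + d).choose (q - 3) := by
      calc 6 * ({C | M.IsCircuit C ∧ C.ncard = 4}.ncard * (p + d).choose (q - 3))
          = 2 * ((3 * {C | M.IsCircuit C ∧ C.ncard = 4}.ncard) * (p + d).choose (q - 3)) := by ring
        _ ≤ 2 * ((d * (d + 1) * (d + 2)) * (p + d).choose (q - 3)) := Nat.mul_le_mul_left _ (Nat.mul_le_mul_right _ hs4)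
        _ = 2 * (d * (d + 1) * (d + 2)) * (p + d).choose (q - 3) := by ring
    have e5 := Nat.mul_le_mul_left 6 h5
    omega
  have hB : B ≤ ((q + 3) * d + 2 * q - 2).choose q := by
    rw [hBdef]
    refine (Finset.sum_le_sum (fun k hk => Nat.mul_le_mul_right _ (hcsT k (by rw [Finset.mem_Icc] at hk; omega)))).trans ?_
    have h := Explicit.tail_sum_le_sparse_all q d ((q + 1) * d)
    have e : 2 * d + 2 * q - 2 + (q + 1) * d = (q + 3) * d + 2 * q - 2 := by
      have : (q + 3) * d = (q + 1) * d + 2 * d := by ring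
      omega
    rwa [e] at h
  -- the level counts in `ℚ`, weighted by `1/(m − q)`; both binomials have the top index `d − 1`
  have hlevel : ∀ m ∈ Finset.Icc (q + 1) d, ({X : Set α | X ⊆ M.E ∧ M.eRk X = q ∧ X.ncard = m}.ncard : ℚ) ≤
      (((q - 1 + d - q).choose (m - (q + 1)) : ℚ) * (A : ℚ) + ((q + d - (q + 1)).choose (m - (q + 1)) : ℚ) * (B : ℚ)) /
        ((m - q : ℕ) : ℚ) := by
    intro m hm
    rw [Finset.mem_Icc] at hm
    have hpos : (0 : ℚ) < ((m - q : ℕ) : ℚ) := by exact_mod_cast (by omega : 0 < m - q)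
    rw [le_div_iff₀ hpos]
    have h := hmul m
    have h' : (((m - q) * {X : Set α | X ⊆ M.E ∧ M.eRk X = q ∧ X.ncard = m}.ncard : ℕ) : ℚ) ≤
        (((q - 1 + d - q).choose (m - (q + 1)) * A + (q + d - (q + 1)).choose (m - (q + 1)) * B : ℕ) : ℚ) := by
      exact_mod_cast h
    push_cast at h'
    linarith
  have hre : ∑ m ∈ Finset.Icc (q + 1) d,
      (((q - 1 + d - q).choose (m - (q + 1)) : ℚ) * (A : ℚ) + ((q + d - (q + 1)).choose (m - (q + 1)) : ℚ) * (B : ℚ)) /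
        ((m - q : ℕ) : ℚ) =
      ∑ j ∈ Finset.range (d - q), (((d - 1).choose j : ℚ) * (A : ℚ) + ((d - 1).choose j : ℚ) * (B : ℚ)) / ((j : ℚ) + 1) := by
    rw [show Finset.Icc (q + 1) d = Finset.image (fun j => q + 1 + j) (Finset.range (d - q)) from ?_]
    · rw [Finset.sum_image (fun a _ b _ h => by omega)]
      apply Finset.sum_congr rfl
      intro j _
      rw [show q + 1 + j - (q + 1) = j by omega, show q + 1 + j - q = j + 1 by omega,
        show q - 1 + d - q = d - 1 by omega, show q + d - (q + 1) = d - 1 by omega]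
      push_cast
      ring
    · ext m
      rw [Finset.mem_Icc, Finset.mem_image]
      constructor
      · intro hm
        exact ⟨m - (q + 1), by rw [Finset.mem_range]; omega, by omega⟩
      · rintro ⟨j, hj, rfl⟩
        rw [Finset.mem_range] at hj
        omega
  -- the (common) weight
  set W : ℚ := ∑ j ∈ Finset.range (d - q), (((d - 1).choose j : ℕ) : ℚ) / ((j : ℚ) + 1) with hWdef
  have hUq : (Matroid.topCount M p q : ℚ) ≤ ((p + d).choose q : ℚ) + (W * (A : ℚ) + W * (B : ℚ)) := by
    have h1 : (Matroid.topCount M p q : ℚ) ≤ ((p + d).choose q : ℚ) +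
        ∑ m ∈ Finset.Icc (q + 1) d, ({X : Set α | X ⊆ M.E ∧ M.eRk X = q ∧ X.ncard = m}.ncard : ℚ) := by
      have := hU1.trans hsum
      rw [hn] at this
      exact_mod_cast this
    have h2 : ∑ m ∈ Finset.Icc (q + 1) d, ({X : Set α | X ⊆ M.E ∧ M.eRk X = q ∧ X.ncard = m}.ncard : ℚ) ≤
        W * (A : ℚ) + W * (B : ℚ) := by
      rw [hWdef, Finset.sum_mul, Finset.sum_mul, ← Finset.sum_add_distrib]
      refine (Finset.sum_le_sum hlevel).trans (hre.le.trans ?_)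
      apply le_of_eq
      apply Finset.sum_congr rfl
      intro j _
      field_simp
    linarith
  -- the weight bound `W·d ≤ 2^d`
  have hW : W * (d : ℚ) ≤ 2 ^ d := by
    have h1 := Explicit.sum_range_choose_div_succ_le (d - 1) (d - q)
    rw [← hWdef, show d - 1 + 1 = d by omega] at h1
    have hdq : ((d - 1 : ℕ) : ℚ) + 1 = (d : ℚ) := by
      have : d - 1 + 1 = d := by omega
      exact_mod_cast this
    have hdpos : (0 : ℚ) < (d : ℚ) := by exact_mod_cast (show 0 < d by omega)
    rw [hdq, le_div_iff₀ hdpos] at h1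
    linarith
  -- (Y): the tail at `K = q + d` (`3(q + d) + 5 ≤ p + d` from `p ≥ 320q` and `p ≥ 3(q+5)d`)
  have hY := Matroid.two_pow_le_midCount_add (M := M) p q hR
  have hAc : {X : Set α | X ⊆ M.E ∧ M.eRk X ≤ q}.ncard ≤ ∑ j ∈ Finset.range (q + d + 1), (p + d).choose j := by
    calc {X : Set α | X ⊆ M.E ∧ M.eRk X ≤ q}.ncard
        ≤ {X : Set α | X ⊆ (M.ground_finite.toFinset : Set α) ∧ X.ncard ≤ q + d}.ncard := by
          apply ncard_le_ncard
          · intro X hX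
            exact ⟨by rw [Set.Finite.coe_toFinset]; exact hX.1, hflat X hX.1 hX.2⟩
          · exact (Finset.finite_toSet _).finite_subsets.subset (fun X hX => hX.1)
      _ ≤ ∑ j ∈ Finset.range (q + d + 1), M.ground_finite.toFinset.card.choose j :=
          ncard_subsets_ncard_le _ (q + d)
      _ = ∑ j ∈ Finset.range (q + d + 1), (p + d).choose j := by rw [hEcard]
  have hBc := Matroid.ncard_spanning_le (M := M) hd
  rw [hEcard] at hY hBc
  have hT : 16 * ∑ j ∈ Finset.range (q + d + 1), (p + d).choose j ≤ 2 ^ (p + d) :=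
    Explicit.sixteen_mul_sum_range_choose_le (q + d) (p + d) (by
      have : 3 * (q + 5) * d ≥ 3 * d := by nlinarith
      omega)
  have hB' : ∑ j ∈ Finset.range (d + 1), (p + d).choose j ≤
      ∑ j ∈ Finset.range (q + d + 1), (p + d).choose j :=
    Finset.sum_le_sum_of_subset_of_nonneg (Finset.range_mono (by omega)) (fun _ _ _ => Nat.zero_le _)
  have hAB : 8 * ({X : Set α | X ⊆ M.E ∧ M.eRk X ≤ q}.ncard +
      {X : Set α | X ⊆ M.E ∧ M.eRk X = M.eRank}.ncard) ≤ 2 ^ (p + d) := by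
    have h2 := hBc.trans hB'
    omega
  -- (Φ) and the polynomial inequality
  have hΦ := phiK_le_two_pow_div p q
  rw [Nat.choose_symm_add] at hΦ
  have hpolyq := hpoly A B W hW hA hB
  rw [add_assoc] at hpolyq
  -- assemble in `ℚ`
  rw [RLS_iff]
  have hYq : (2 : ℚ) ^ (p + d) ≤ (Matroid.midCount M p q : ℚ) +
      ({X : Set α | X ⊆ M.E ∧ M.eRk X ≤ q}.ncard : ℚ) +
      ({X : Set α | X ⊆ M.E ∧ M.eRk X = M.eRank}.ncard : ℚ) := by exact_mod_cast hY
  have hABq : 8 * (({X : Set α | X ⊆ M.E ∧ M.eRk X ≤ q}.ncard : ℚ) +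
      ({X : Set α | X ⊆ M.E ∧ M.eRk X = M.eRank}.ncard : ℚ)) ≤ 2 ^ (p + d) := by exact_mod_cast hAB
  have hU0 : (0 : ℚ) ≤ (Matroid.topCount M p q : ℚ) := Nat.cast_nonneg _
  exact level_arith (p := p) (d := d) (n := p + d) (q := q) rfl (by omega) hΦ hU0 hUq hYq hABq hpolyq

/-- **THE CELL MAP**: the `e`-free core at level `q ≥ 8`, rank `p ≥ Tcell2 q d k`, corank `d ≥ q + 2` with
`d + 2 ≤ k²` and `3k² ≤ 2^q`, satisfies `RLS M p q` (`c025_core_cell_of_poly` with `poly_cells`). -/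
theorem c025_core_cell_lin2 (q : ℕ) (hq : 8 ≤ q) (M : Matroid α) [M.Finite] (p d k : ℕ)
    (hd1 : q + 2 ≤ d) (hk : d + 2 ≤ k ^ 2) (hk3 : 3 * k ^ 2 ≤ 2 ^ q) (hp : Explicit.Tcell2 q d k ≤ p)
    (hR : M.eRank = (p : ℕ∞)) (hn : M.E.ncard = p + d)
    (hfree : ∀ e ∈ M.E, ∃ A ⊆ M.E \ {e}, e ∉ M.closure A ∧ e ∉ M.closure ((M.E \ {e}) \ A)) :
    RLS M p q :=
  c025_core_cell_of_poly q hq M p d (by omega) (Explicit.Tcell2_facts q d k p hp).1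
    (Explicit.Tcell2_facts q d k p hp).2.1
    (fun A B W hW hA hB => Explicit.poly_cells q d p k hq hd1 hk hk3 hp A B W W hW hW hA hB) hR hn hfree

/-- Level `10`, corank `12` (`k = 4`): the core cell closes from `p = 3 840` (uniform: `20 480`). -/
theorem c025_core_cell_ten_twelve (M : Matroid α) [M.Finite] (p : ℕ) (hp : 3840 ≤ p)
    (hR : M.eRank = (p : ℕ∞)) (hn : M.E.ncard = p + 12)
    (hfree : ∀ e ∈ M.E, ∃ A ⊆ M.E \ {e}, e ∉ M.closure A ∧ e ∉ M.closure ((M.E \ {e}) \ A)) : RLS M p 10 :=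
  c025_core_cell_lin2 10 (by norm_num) M p 12 4 (by norm_num) (by norm_num) (by norm_num)
    (by unfold Explicit.Tcell2; norm_num; omega) hR hn hfree

/-- Level `10`, corank `100` (`k = 11`): the core cell closes from `p = 10 560`. -/
theorem c025_core_cell_ten_hundred (M : Matroid α) [M.Finite] (p : ℕ) (hp : 10560 ≤ p)
    (hR : M.eRank = (p : ℕ∞)) (hn : M.E.ncard = p + 100)
    (hfree : ∀ e ∈ M.E, ∃ A ⊆ M.E \ {e}, e ∉ M.closure A ∧ e ∉ M.closure ((M.E \ {e}) \ A)) : RLS M p 10 :=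
  c025_core_cell_lin2 10 (by norm_num) M p 100 11 (by norm_num) (by norm_num) (by norm_num)
    (by unfold Explicit.Tcell2; norm_num; omega) hR hn hfree

/-- Level `11`, corank `13` (`k = 4`): from `p = 8 448` (uniform `45 056`). -/
theorem c025_core_cell_eleven_thirteen (M : Matroid α) [M.Finite] (p : ℕ) (hp : 8448 ≤ p)
    (hR : M.eRank = (p : ℕ∞)) (hn : M.E.ncard = p + 13)
    (hfree : ∀ e ∈ M.E, ∃ A ⊆ M.E \ {e}, e ∉ M.closure A ∧ e ∉ M.closure ((M.E \ {e}) \ A)) : RLS M p 11 :=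
  c025_core_cell_lin2 11 (by norm_num) M p 13 4 (by norm_num) (by norm_num) (by norm_num)
    (by unfold Explicit.Tcell2; norm_num; omega) hR hn hfree

/-- Level `12`, corank `14` (`k = 4`): from `p = 9 216` (uniform `98 304`). -/
theorem c025_core_cell_twelve_fourteen (M : Matroid α) [M.Finite] (p : ℕ) (hp : 9216 ≤ p)
    (hR : M.eRank = (p : ℕ∞)) (hn : M.E.ncard = p + 14)
    (hfree : ∀ e ∈ M.E, ∃ A ⊆ M.E \ {e}, e ∉ M.closure A ∧ e ∉ M.closure ((M.E \ {e}) \ A)) : RLS M p 12 :=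
  c025_core_cell_lin2 12 (by norm_num) M p 14 4 (by norm_num) (by norm_num) (by norm_num)
    (by unfold Explicit.Tcell2; norm_num; omega) hR hn hfree

end ThmN

end PercRepro
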